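/-
Copyright: lit-balaban Phase-2 proof seat p09 (gen 6).  Statement-level skeleton of a published paper; no proof claims beyond what the
kernel checks below.
-/
import Literature.MathematicalPhysics.QuantumFieldTheory.BalabanImbrieJaffe1984to88.BIJ85Eq431DeltaKBridge
import Literature.MathematicalPhysics.QuantumFieldTheory.BalabanImbrieJaffe1984to88.BIJ85Ineq434Proof

/-!
# `BalabanImbrieJaffe1984to88.BIJ85Ineq723TorusCornerGauge` — T. Bałaban, J. Imbrie, A. Jaffe, *Renormalization of the Higgs model: minimizers,
propagators and the stability of mean field theory*, Commun. Math. Phys. **97** (1985) 299–329 [BalabanImbrieJaffe1985], p. 311 (4.3.3)–(4.3.5) and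
p. 325 **(7.2.3) `|C^{(k)}_{μν}(x, y)| ≤ Me^{−δ|x−y|}` PROVED WITH NO HYPOTHESIS ON THE TORI OF THE SERIES FOR THE ACTUAL Δ_k OF (4.3.1)**, the
constraint `δ(QB)δ_{Ax}(B)` of (4.3.3) read with the corner-rooted staircases of T. Bałaban, *Propagators and renormalization transformations for
lattice gauge theories. I/II*, Commun. Math. Phys. **95** (1984) 17–40 / **96** (1984) 223–250 [Balaban1984PropagatorsI] (1.6)–(1.10) /
[Balaban1984PropagatorsII] (2.152)–(2.157) — together with (2.153), (4.3.4) and (2.156) for the same objects; `M, δ` depend on `d` and `L` only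

statement-level skeleton of published theorems with citation tags; proofs where landed; nothing here is a claim about the Yang–Mills mass gap

PDF held: `paper:balaban1985-cmp97-bij-higgs-minimizers` (journal page = PDF page + 298); pp. 311, 325 [PDF 13, 27] read this session from the
materialised text (`~/.lit/texts/paper-balaban1985-cmp97-bij-higgs-minimizers/p0013.txt`, `p0027.txt`); [6II] pp. 249–250 through the verbatim
quotations in the headers of `…Balaban1983to89.B6Cov2156Torus`/`B6Cov2156TorusDelK` (pub-balaban cell; page renders cited there).

THE PRINTED TEXT (verbatim).  p. 311: *"The action Δ_k yields the unit lattice propagator C^{(k)}, defined as follows: exp(½⟨J, C^{(k)}J⟩) =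
(Z^{(k)})^{−1}∫𝒟Bδ(QB)δ_{Ax}(B)exp(−½⟨B, Δ_kB⟩ + ⟨B, J⟩). (4.3.3) The actions Δ_k and propagators C^{(k)} were studied by Balaban [6II] who
established that C^{(k)} is well defined and is bounded in norm ‖C^{(k)}‖ ≤ c (4.3.4) uniformly in k. Furthermore C^{(k)} has a kernel which
decays exponentially, uniformly in k. |C^{(k)}(x, y)| ≤ a exp(−b|x − y|). (4.3.5)"*; p. 325: *"The unit lattice propagator C^{(k)} also has
exponential decay, |C^{(k)}_{μν}(x, y)| ≤ Me^{−δ|x−y|}, (7.2.3) for x, y ∈ T₁^{(k)}. This inequality follows from the bound (2.157) in [6II] and from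
the general theorem on unit lattice operators in [7]."*  [6II] p. 249–250: *"⟨B, Δ_kB⟩ ≥ (γ₀/12d²)L^{−d−1}‖B‖², or Δ_k ≥ (γ₀/12d²)L^{−d−1} (2.153) on
the subspace of B satisfying: QB = 0, B(Γ_{y,x}) = 0 for x ∈ B(y). … we can write B = CB′, where C is a linear operator … C^{(k)}_Λ = C(C*Δ_kC)⁻¹C*.
(2.156) … C is a short-ranged operator, so C*Δ_kC has the same exponential decay as Δ_k. Now we may apply the theory developed in Sect. 5 of [3] on
unit lattice operators. It gives us an exponential decay, and all the other properties, for the operator (C*Δ_kC)⁻¹, hence for C^{(k)}_Λ also."*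

CITATION HEADER (lean-in-tree rule).  Part of the lit-balaban TYPED SKELETON (HOME `run/shared/lean/pub/lit-balaban/`), Phase-2 seat p09 GEN 6,
file 2 of the programme «(7.2.3) for the ACTUAL C^{(k)}» (file 1 = `BIJ85Eq431DeltaKBridge`: the (4.3.1) action on the tori IS [6I] (1.19)/(1.65)
Δ_k = `Re Beta.BlockEffectiveAction.DelK`, kernel decay); rows **C1.Eq7.2.3**, **C1.Eq4.3.4-4.3.5**, **C1.Eq4.3.1-4.3.3** (the (4.3.3) member) of
`HOME/SKELETON.md` (owner r15, referee ref-5) and the junction with rows **B6.Eq2.152–2.157** (owner r03; pub-balaban `B6Cov2156Torus*`).  The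
gen-3 file `BIJ85Ineq434Proof` proved (4.3.4)/(4.3.5)/(7.2.3) for the (4.3.3) operator `unitPropagator V D Qs W` from three [6II] inputs OF
PRINTED SHAPE; HERE, for the torus instance of record — `V = V411 P k`, `D = curlOp (η^d) (L^k)`, `Qs = QsE P k` (seats p09/p30, the objects of
`BIJ85Prop521Torus`/`BIJ85Eq611Torus`) and the constraint subspace `Wcorner P k` = {QB = 0, B(Γ_{y,x}) = 0} with BAŁABAN'S CORNER-ROOTED
STAIRCASES — every input is a THEOREM: (2.153) from pv09's `B6Cov2156TorusDelK.lowerOnConstrainedT_reDelK_sharp`, the decay of Δ_k and `hMΔ` from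
file 1, the parametrisation `C` = pv09's explicit `B6Cov2156Torus.elimT`, and Sect. 5 of [7] inside pv09's `cov2156_torus_DelK`.  Decls used BY
NAME (nothing restated): gen-3 `BIJ85Ineq434Proof.kernel_unitPropagator_eq_2156/noZeroModes_of_coercive/coercive_iff/norm_unitPropagator_le`; pv09
`B6Cov2156Torus.{elimT, freeT, restrT, perExt, elimT_restrT, q1_elimT_mulVec, elimT_mulVec_tree, bondReductionT}`, `B6Cov2156TorusDelK.{idxEquiv,
reDelK, reDelK_apply, gamma2153one, lowerOnConstrainedT_reDelK_sharp, sandwich_posDef_reDelK, cov2156_torus_DelK}`, `B6Lemma24PrintedShape.q1`,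
`B6BondElimination.IsTree`, `B6Lemma24Torus.{pbox, coarseSites, faces, wrap}`, `B6LowerBound2153Torus.{toT, rep}`; r18 `LatticeFieldCalculus.bondAvg/
supDist`; p38/p16/p21 through file 1.

WHAT IS PROVED (kernel; `d ≥ 2`, standing range `k + 1 ≤ m + K` — there is a next scale, so `L` divides the periods of `T₁^{(k)}`; physical
normalisation `w = η^d`, `c = η⁻¹ = L^k`):
* §0 the carriers: `idx : PBond P k ≃ B4.Idx (pbox (Mk P k)) d` (the bonds of `T₁^{(k)}` ARE the variables of pv09's box), the elimination matrix
  `MC` (= `elimT` with rows on `PBond P k`), the constraint subspace **`Wcorner P k`** (= range of `C`), `mem_Wcorner_iff_box`.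
* §1 **«QB = 0» = «(Q₁B^per)(c) = 0 at every coarse bond»**: `bondAvg_eq_q1` (the V1 one-step average (1.11) at `c` IS pv09's (2.125) `q1` at
  `faceOf c`, exactly, every torus), `bondAvg_eq_zero_iff`.
* §2 **`mem_Wcorner_iff`**: `B ∈ Wcorner ↔ bondAvg B = 0 ∧ B = 0 on the corner-rooted tree bonds`.
* §3 **(2.153) for the (4.3.1) operator on `Wcorner`, no hypothesis**: `coercive_corner` (`(1/12d²)L^{−d−1}‖B‖² ≤ ⟨B, Δ_kB⟩`), `coercive_corner'`,
  `noZeroModes_corner`; **(4.3.4) on the tori, no hypothesis**: `norm_unitPropagator_corner_le` (`‖C^{(k)}J‖ ≤ 12d²L^{d+1}‖J‖`, `0 ≤ ⟨J,C^{(k)}J⟩ ≤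
  12d²L^{d+1}‖J‖²`), `inv_gamma2153one`.
* §4 **(2.156) on the tori**: `kernel_corner_eq_cov` — the kernel of `unitPropagator … Wcorner` IS pv09's `C(C*(Re Δ_k)C)⁻¹C*` reindexed;
  **(7.2.3)/(4.3.5), no hypothesis**: `ineq723_corner` — ∃ `M, δ > 0` depending on `(d, L)` ONLY with `|C^{(k)}(b, b′)| ≤ Me^{−δ·supDist(b₋, b′₋)}` for
  every torus of these `(d, L)`, every `k + 1 ≤ m + K`, all bonds; `ineq723_corner_record` (r15's `KernelData.Ineq723 M δ` for every carrier reading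
  this kernel and `supDist`).
HONEST SCOPE.  (i) THE GAUGE: `Wcorner` fixes the axial gauge along the staircases rooted at the block CORNERS ([6I] (1.6)–(1.7), the pub-balaban
typing, = [BalabanImbrieJaffe1985] (2.4)/(3.4) which also anchor blocks at a corner); the series' cross-paper calculus `LatticeFieldCalculus.IsAxial`
roots them at the block CENTRES (DIVERGENCE F3 of `pub-balaban`), and the corresponding subspace `BIJ85Prop521Torus.Wstep` — the `W` of seat p30's
(5.2.1)/(6.1.1) torus files — is a DIFFERENT subspace with a different propagator; (7.2.3) for it needs the block-local regauging between the two
trees (file 3 of the programme) and is NOT claimed here.  (ii) Torus (periodic b.c.), U = 1, real abelian fields; `d ≥ 2` (as in [6II] (2.153)).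
(iii) Constants: γ = (1/12d²)L^{−d−1} (β cell's γ₀ = 1), `c = γ⁻¹` explicit; `(M, δ)` existential from pv09's engine (chosen from `(d, L)` before the
torus).  (iv) «Dirichlet boundary conditions outside Λ, uniformly in Λ» (p. 325) is not restated here (gen 3 `kernel_decay_dirichlet` + pv09
`cov2156_torus_subset_DelK` would give it the same way).  (v) Five `def`s with bodies (`idx`, `MC`, `box`, `Wcorner`, `faceOf`; two private), no
`def … : Prop`, no new named fact (D-0026).  Unit `lit-balaban-p09` (literature-prover-lit-balaban-p09-g6-0), 2026-08-21.
-/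

namespace Literature.MathematicalPhysics.QuantumFieldTheory.BalabanImbrieJaffe1984to88.BIJ85Ineq723TorusCornerGauge

open Literature.MathematicalPhysics.QuantumFieldTheory.Balaban1983to89
open scoped BigOperators Matrix RealInnerProductSpace
open LatticeFieldCalculus
open BIJ85AxialPropagator411 (constraint411 mem_constraint411 BondSpace toE curlOp V411)
open BIJ85UnitPropagator433 (Hop deltaOp inner_deltaOp unitPropagator)
open BIJ85Prop521Torus (CoarseSpace toEj QsE)
open BIJ85Eq431DeltaKBridge (torIdx one_le_Lpow eta_pow_pos Lpow_ne_zero deltaOp_apply toEuclideanLin_DeltaK_eq_deltaOp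
  DeltaK_entry_eq_re_DelK pdist_rep_eq_supDist)
open B5Prop11Plancherel (Tor)
open B5Eq117TorusCarriers (Mk)
open B6Lemma24Torus (pbox coarseSites faces)
open B6BondElimination (IsTree)
open B6Lemma24PrintedShape (q1)
open B6LowerBound2153Torus (toT rep)
open B6Cov2156Torus (one_le_M perExt freeT elimT restrT elimT_mulVec_free elimT_mulVec_tree q1_elimT_mulVec elimT_restrT
  bondReductionT bondReductionT_cov)
open B6Cov2156TorusDelK (idxEquiv idxEquiv_apply idxEquiv_symm_apply reDelK reDelK_apply gamma2153one gamma2153one_pos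
  lowerOnConstrainedT_reDelK_sharp sandwich_posDef_reDelK cov2156_torus_DelK)

noncomputable section

variable {P : Params} {k : ℕ}

/-! ## §0  The carriers: the unit-lattice bonds of `T₁^{(k)}` ARE the variables of the box of the torus `Tor (Mk P k)` -/

/-- `L ∣` the periods of the unit lattice `T₁^{(k)}` whenever there is a next scale (`k + 1 ≤ m + K`): the blocks of the (k+1)-st step tile the
torus. [cite: Balaban1984PropagatorsI, (1.6) p.18] -/
theorem L_dvd_Mk (hk : k + 1 ≤ P.m + P.K) : ∀ i, P.L ∣ Mk P k i := fun _ =>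
  ⟨P.sitesPerDir (k + 1), by rw [mul_comm]; exact P.sitesPerDir_eq_mul_succ hk⟩

/-- **the index dictionary** `PBond P k ≃ B4.Idx (pbox (Mk P k)) d`: the bond `⟨x, x + e_μ⟩` of `T₁^{(k)}` IS the variable `(rep x, μ)` of the box
of the pub-balaban torus line (`B6Cov2156TorusDelK.idxEquiv` after `torIdx`). [cite: Balaban1984PropagatorsII, (2.152) p.249] -/
def idx (P : Params) (k : ℕ) : PBond P k ≃ B4.Idx (pbox (Mk P k)) P.d :=
  (bondEquiv (P := P) (j := k)).symm.trans (idxEquiv (Mk P k)).symm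

/-- `idx b = idxEquiv⁻¹ (b₋, μ)`. [cite: Balaban1984PropagatorsII, (2.152) p.249] -/
theorem idx_apply (b : PBond P k) : idx P k b = (idxEquiv (Mk P k)).symm (torIdx b) := rfl

/-- `idxEquiv (idx b) = (b₋, μ)`. [cite: Balaban1984PropagatorsII, (2.152) p.249] -/
theorem idxEquiv_idx (b : PBond P k) : idxEquiv (Mk P k) (idx P k b) = torIdx b :=
  (idxEquiv (Mk P k)).apply_symm_apply _

/-- `idx⁻¹ (x, μ) = ⟨x mod M, μ⟩`. [cite: Balaban1984PropagatorsII, (2.152) p.249] -/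
theorem idx_symm_apply (p : B4.Idx (pbox (Mk P k)) P.d) :
    (idx P k).symm p = (⟨toT (Mk P k) (p.1 : Fin P.d → ℤ), p.2⟩ : PBond P k) := rfl

/-- the integer representative of the source: `(idx b).1 = rep b₋`. [cite: Balaban1984PropagatorsII, (2.152) p.249] -/
theorem idx_fst_coe (b : PBond P k) : ((idx P k b).1 : Fin P.d → ℤ) = rep (Mk P k) b.src := rfl

/-- **the elimination matrix `C` of [6II] p. 250 on the unit lattice of `Setup`** (`B = CB′`; pv09's explicit `B6Cov2156Torus.elimT` with its
rows read on `PBond P k`): a remaining variable is copied, a tree bond is set to `0`, the pivot of a face is solved from `δ((QB)(c))`.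
[cite: Balaban1984PropagatorsII, (2.155)–(2.156) p.250] -/
def MC (P : Params) (k : ℕ) : Matrix (PBond P k) (freeT P.L (Mk P k)) ℝ := fun b f => elimT P.L (Mk P k) (idx P k b) f

/-- `MC` is `elimT` with reindexed rows. [cite: Balaban1984PropagatorsII, (2.155) p.250] -/
theorem MC_eq_submatrix : MC P k = (elimT P.L (Mk P k)).submatrix (idx P k) id := rfl

/-- `(MC·x)(b) = (C·x)(idx b)`. [cite: Balaban1984PropagatorsII, (2.155) p.250] -/
theorem MC_mulVec_apply (x : freeT P.L (Mk P k) → ℝ) (b : PBond P k) :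
    (MC P k *ᵥ x) b = (elimT P.L (Mk P k) *ᵥ x) (idx P k b) := rfl

/-- a field on the unit-lattice bonds read on the variables of the box. [cite: Balaban1984PropagatorsII, (2.152) p.249] -/
def box (B : PBond P k → ℝ) : B4.Idx (pbox (Mk P k)) P.d → ℝ := fun p => B ((idx P k).symm p)

/-- `box (MC·x) = C·x`. [cite: Balaban1984PropagatorsII, (2.155) p.250] -/
theorem box_MC_mulVec (x : freeT P.L (Mk P k) → ℝ) : box (MC P k *ᵥ x) = elimT P.L (Mk P k) *ᵥ x := by
  funext p
  rw [box, MC_mulVec_apply, Equiv.apply_symm_apply]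

/-- sums over the bonds are sums over the variables of the box. [folklore] -/
private theorem sum_box (g : B4.Idx (pbox (Mk P k)) P.d → ℝ) : ∑ b : PBond P k, g (idx P k b) = ∑ p, g p :=
  Fintype.sum_equiv (idx P k) _ _ fun _ => rfl

/-- **THE CONSTRAINT SUBSPACE OF (4.3.3)/(2.152) IN BAŁABAN'S AXIAL GAUGE on the tori of `Setup`**: `W = {B : QB = 0, B(Γ_{y,x}) = 0 for x ∈ B(y)}`
with the staircases `Γ_{y,x}` issued from the block CORNERS ([Balaban1984PropagatorsI] (1.6)–(1.7), (1.10); the pub-balaban typing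
`B6BondElimination.IsTree`), realised as the range of `C` (p. 250: *"B = CB′ … (CB′)(Γ_{y,x}) = 0 … QCB′ = 0 for arbitrary B′"*; membership =
the two constraints, `mem_Wcorner_iff`).  (The cross-paper calculus `LatticeFieldCalculus.IsAxial` of the series' V1 files roots the
staircases at the block CENTRES — DIVERGENCE F3 of `pub-balaban`; that subspace is `BIJ85Prop521Torus.Wstep`, not this one.)
[cite: BalabanImbrieJaffe1985, (4.3.3) p.311; Balaban1984PropagatorsII, (2.152)–(2.155) pp.249–250] -/
def Wcorner (P : Params) (k : ℕ) : Submodule ℝ (CoarseSpace P k) :=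
  LinearMap.range ((toEj P k).toLinearMap ∘ₗ (MC P k).mulVecLin)

/-- membership in the range form. [cite: Balaban1984PropagatorsII, (2.155) p.250] -/
theorem mem_Wcorner_range (B : CoarseSpace P k) : B ∈ Wcorner P k ↔ ∃ x, toEj P k (MC P k *ᵥ x) = B := by
  simp only [Wcorner, LinearMap.mem_range, LinearMap.comp_apply, Matrix.mulVecLin_apply, LinearEquiv.coe_toLinearMap]

/-- `C·x ∈ W`. [cite: Balaban1984PropagatorsII, (2.155) p.250] -/
theorem MC_mulVec_mem (x : freeT P.L (Mk P k) → ℝ) : toEj P k (MC P k *ᵥ x) ∈ Wcorner P k :=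
  (mem_Wcorner_range _).2 ⟨x, rfl⟩

/-- **`W` by its two constraints, box form**: `B ∈ W` iff `(Q₁B^per)(c) = 0` at every coarse bond `c` of the torus ((2.125) verbatim, pv09's `q1`
on the periodic extension) and `B = 0` on the tree bonds `Γ_y` of every block (pv09's `elimT_restrT`, `q1_elimT_mulVec`, `elimT_mulVec_tree`).
[cite: Balaban1984PropagatorsII, (2.153)–(2.155) pp.249–250] -/
theorem mem_Wcorner_iff_box (hk : k + 1 ≤ P.m + P.K) (B : CoarseSpace P k) :
    B ∈ Wcorner P k ↔
      (∀ c ∈ faces P.L (Mk P k), q1 P.L (perExt (Mk P k) (box (WithLp.ofLp B))) c = 0) ∧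
        ∀ p, IsTree P.L (coarseSites P.L (Mk P k)) p → B ((idx P k).symm p) = 0 := by
  rw [mem_Wcorner_range]
  constructor
  · rintro ⟨x, rfl⟩
    have hb : box (WithLp.ofLp (toEj P k (MC P k *ᵥ x))) = elimT P.L (Mk P k) *ᵥ x := box_MC_mulVec x
    refine ⟨fun c hc => ?_, fun p hp => ?_⟩
    · rw [hb]
      exact q1_elimT_mulVec P.L_pos (L_dvd_Mk hk) x hc
    · have h := elimT_mulVec_tree (L := P.L) (M := Mk P k) x hp
      rw [← hb] at h
      exact h
  · rintro ⟨hQ, hT⟩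
    refine ⟨restrT (box (WithLp.ofLp B)), ?_⟩
    have h := elimT_restrT (L := P.L) (M := Mk P k) P.L_pos (L_dvd_Mk hk) (B := box (WithLp.ofLp B)) hQ
      (fun p hp => hT p hp)
    have h2 : MC P k *ᵥ restrT (box (WithLp.ofLp B)) = WithLp.ofLp B := by
      funext b
      rw [MC_mulVec_apply, h, box, Equiv.symm_apply_apply]
    rw [h2]
    rfl

/-! ## §1  The averaging constraint: «QB = 0» of (4.3.3) on `T₁^{(k)}` (`LatticeFieldCalculus.bondAvg`, [6I] (1.11)) IS pv09's (2.125) reading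
`(Q₁B^per)(c) = 0` at every coarse bond of the torus -/

/-- the coarse bond `⟨y, y + e_μ⟩` of `T^{(k+1)}` read as the face `(L·y, μ)` of the pub-balaban torus (corner `L·y` of the block `B(y)` in the
labels of `T₁^{(k)}`). [cite: Balaban1984PropagatorsI, (1.6) p.18] -/
def faceOf (c : PBond P (k + 1)) : (Fin P.d → ℤ) × Fin P.d := (fun i => (P.L : ℤ) * ((c.src i).val : ℤ), c.dir)

/-- `faceOf c` is a coarse bond of the torus (`L·y ∈ T′`, `L ∣ L·y`). [cite: Balaban1984PropagatorsI, (1.6) p.18] -/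
theorem faceOf_mem (hk : k + 1 ≤ P.m + P.K) (c : PBond P (k + 1)) : faceOf c ∈ faces P.L (Mk P k) := by
  rw [B6Lemma24Torus.mem_faces, B6Lemma24Torus.mem_coarseSites, B6Lemma24Torus.mem_pbox]
  refine ⟨fun i => ⟨by unfold faceOf; positivity, ?_⟩, fun i => ⟨((c.src i).val : ℤ), rfl⟩⟩
  have h1 : (c.src i).val < P.sitesPerDir (k + 1) := ZMod.val_lt _
  have h2 : P.sitesPerDir k = P.sitesPerDir (k + 1) * P.L := P.sitesPerDir_eq_mul_succ hk
  show (P.L : ℤ) * ((c.src i).val : ℤ) < ((P.sitesPerDir k : ℕ) : ℤ)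
  rw [h2]
  push_cast
  nlinarith [P.L_pos]

/-- the block point of offset `r` as an integer label vector `L·y + r`. [cite: Balaban1984PropagatorsI, (1.6) p.18] -/
private def bpt (y : Balaban1983to89.Site P (k + 1)) (r : Fin P.d → Fin P.L) : Fin P.d → ℤ := fun i => (P.L : ℤ) * ((y i).val : ℤ) + ((r i : ℕ) : ℤ)

/-- `L·y + r ∈ B(L·y)` for offsets `r ∈ {0,…,L−1}^d`. [folklore] -/
private theorem bpt_mem_block (y : Balaban1983to89.Site P (k + 1)) (μ : Fin P.d) (r : Fin P.d → Fin P.L) :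
    bpt y r ∈ B6Elimination.block P.L (faceOf (⟨y, μ⟩ : PBond P (k + 1))).1 := by
  rw [B6Elimination.mem_block]
  intro i
  have := (r i).isLt
  simp only [bpt, faceOf]
  constructor <;> omega

/-- casting the wrapped label gives the same torus point. [folklore] -/
private theorem toT_wrap (M : Fin P.d → ℕ) (z : Fin P.d → ℤ) : toT M (B6Lemma24Torus.wrap M z) = toT M z := by
  funext i
  simp only [toT, B6Lemma24Torus.wrap, ZMod.intCast_mod]

/-- the straight contour of (1.8)/(1.11) issued from `L·y + r`: its `s`-th site IS `runSite (blockSite y r) μ s` of the V1 calculus.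
[cite: Balaban1984PropagatorsI, (1.8) p.19] -/
private theorem toT_bpt_add (y : Balaban1983to89.Site P (k + 1)) (r : Fin P.d → Fin P.L) (μ : Fin P.d) (s : ℕ) :
    toT (Mk P k) (bpt y r + (s : ℤ) • B6BondElimination.unitVec μ) = runSite (Balaban1983to89.Site.blockSite y r) μ s := by
  funext i
  by_cases hi : i = μ
  · subst hi
    simp only [toT, runSite, Function.update_self, Balaban1983to89.Site.blockSite, B6BondElimination.add_smul_unitVec_apply, bpt]
    push_cast
    ring
  · simp only [toT, runSite, Function.update_of_ne hi, Balaban1983to89.Site.blockSite, B6BondElimination.add_smul_unitVec_apply,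
      bpt, if_neg hi]
    push_cast
    ring

/-- **«QB = 0» = «(Q₁B^per)(c) = 0»**: the one-step block average (1.11) of the V1 calculus at the coarse bond `c` IS pv09's (2.125) `q1` of the
periodic extension of the box field at the face `faceOf c`. [cite: Balaban1984PropagatorsI, (1.11) p.19; Balaban1984PropagatorsII, (2.125) p.245] -/
theorem bondAvg_eq_q1 (A : VecField P k ℝ) (c : PBond P (k + 1)) :
    bondAvg A c = q1 P.L (perExt (Mk P k) (box A)) (faceOf c) := by
  obtain ⟨y, μ⟩ := c
  rw [bondAvg, q1, ← Finset.mul_sum, smul_eq_mul]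
  congr 1
  refine Finset.sum_bij' (fun r _ => bpt y r) (fun x hx i => ⟨(x i - (P.L : ℤ) * ((y i).val : ℤ)).toNat, ?_⟩) ?_ ?_ ?_ ?_ ?_
  · have h := (B6Elimination.mem_block.1 hx) i
    simp only [faceOf] at h
    omega
  · intro r _
    exact bpt_mem_block y μ r
  · intro x _
    exact Finset.mem_univ _
  · intro r _
    funext i
    apply Fin.ext
    simp [bpt]
  · intro x hx
    funext i
    have h := (B6Elimination.mem_block.1 hx) i
    simp only [faceOf] at h
    simp only [bpt]
    omega
  · intro r _
    rw [segSum, B6Lemma24PrintedShape.segSum]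
    refine Finset.sum_congr rfl fun s _ => ?_
    change A (runBond (Balaban1983to89.Site.blockSite y r) μ s) =
      A ⟨toT (Mk P k) (B6Lemma24Torus.wrap (Mk P k) (bpt y r + (s : ℤ) • B6BondElimination.unitVec μ)), μ⟩
    rw [runBond, toT_wrap, toT_bpt_add]

/-- every face of the torus is `faceOf` of a coarse bond of `T^{(k+1)}`. [cite: Balaban1984PropagatorsI, (1.6) p.18] -/
theorem exists_faceOf_eq (hk : k + 1 ≤ P.m + P.K) {c' : (Fin P.d → ℤ) × Fin P.d} (hc' : c' ∈ faces P.L (Mk P k)) :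
    ∃ c : PBond P (k + 1), faceOf c = c' := by
  obtain ⟨y, ν⟩ := c'
  rw [B6Lemma24Torus.mem_faces, B6Lemma24Torus.mem_coarseSites, B6Lemma24Torus.mem_pbox] at hc'
  obtain ⟨hbox, hdvd⟩ := hc'
  have hL : (0 : ℤ) < P.L := by exact_mod_cast P.L_pos
  have hq : ∀ i, 0 ≤ y i / (P.L : ℤ) ∧ y i / (P.L : ℤ) < P.sitesPerDir (k + 1) := fun i => by
    obtain ⟨h0, h1⟩ := hbox i
    refine ⟨Int.ediv_nonneg h0 hL.le, ?_⟩
    rw [Int.ediv_lt_iff_lt_mul hL]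
    have h2 : P.sitesPerDir k = P.sitesPerDir (k + 1) * P.L := P.sitesPerDir_eq_mul_succ hk
    have h3 : ((Mk P k i : ℕ) : ℤ) = (P.sitesPerDir (k + 1) : ℤ) * (P.L : ℤ) := by
      show ((P.sitesPerDir k : ℕ) : ℤ) = _
      rw [h2]; push_cast; ring
    linarith [h3 ▸ h1]
  refine ⟨⟨fun i => (((y i / (P.L : ℤ)).toNat : ℕ) : ZMod (P.sitesPerDir (k + 1))), ν⟩, ?_⟩
  simp only [faceOf, Prod.mk.injEq, and_true]
  funext i
  obtain ⟨h0, h1⟩ := hq i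
  rw [ZMod.val_natCast, Nat.mod_eq_of_lt (by omega), Int.toNat_of_nonneg h0]
  exact Int.mul_ediv_cancel' (hdvd i)

/-- **«QB = 0» ON `T₁^{(k)}` ⟺ «(Q₁B^per)(c) = 0 at every coarse bond of the torus»** (the averaging half of the constraint of (4.3.3)/(2.152) in the
two typings). [cite: Balaban1984PropagatorsI, (1.11) p.19; Balaban1984PropagatorsII, (2.125) p.245] -/
theorem bondAvg_eq_zero_iff (hk : k + 1 ≤ P.m + P.K) (A : VecField P k ℝ) :
    bondAvg A = 0 ↔ ∀ c' ∈ faces P.L (Mk P k), q1 P.L (perExt (Mk P k) (box A)) c' = 0 := by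
  constructor
  · intro h c' hc'
    obtain ⟨c, rfl⟩ := exists_faceOf_eq hk hc'
    rw [← bondAvg_eq_q1, h]
    rfl
  · intro h
    funext c
    rw [bondAvg_eq_q1]
    exact h _ (faceOf_mem hk c)

/-! ## §2  Membership in `W` in the language of the series' lattice calculus -/

/-- **`B ∈ W` iff `QB = 0` (the one-step block average `LatticeFieldCalculus.bondAvg` of (1.11)) and `B` vanishes on the bonds of Bałaban's
corner-rooted staircase trees `Γ_y` of the blocks** (pub-balaban `B6BondElimination.IsTree`; `k + 1 ≤ m + K`).
[cite: BalabanImbrieJaffe1985, (4.3.3) p.311; Balaban1984PropagatorsII, (2.153) p.249] -/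
theorem mem_Wcorner_iff (hk : k + 1 ≤ P.m + P.K) (B : CoarseSpace P k) :
    B ∈ Wcorner P k ↔
      bondAvg (WithLp.ofLp B) = 0 ∧ ∀ p, IsTree P.L (coarseSites P.L (Mk P k)) p → B ((idx P k).symm p) = 0 := by
  rw [mem_Wcorner_iff_box hk, bondAvg_eq_zero_iff hk]

/-! ## §3  (2.153) ON `W` FOR THE (4.3.1) OPERATOR `Δ_k = (∂H_{k,Ax})^*(∂H_{k,Ax})` of the tori — `hcoer` DISCHARGED -/

/-- the quadratic form of the (4.3.1) operator in the box variables: `⟨B, Δ_kB⟩ = Σ_p X_p((Re Δ_k)X)_p`, `X = box B`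
(`BIJ85Eq431DeltaKBridge`: the (4.3.1) matrix is `Re Δ_k` of the genuine (1.65) operator entrywise).
[cite: BalabanImbrieJaffe1985, (4.3.1) p.311; Balaban1984PropagatorsI, (1.65) p.29] -/
theorem inner_deltaOp_eq_box_form (hk : k ≤ P.m + P.K) (B : CoarseSpace P k) :
    ⟪B, deltaOp (V411 P k) (curlOp (P := P) (P.eta k ^ P.d) ((P.L : ℝ) ^ k)) (QsE P k) B⟫ =
      ∑ p, box (WithLp.ofLp B) p * (reDelK (P.L ^ k) (one_le_Lpow P k) (Mk P k) *ᵥ box (WithLp.ofLp B)) p := by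
  haveI : NeZero (P.L ^ k) := ⟨by have := one_le_Lpow P k; omega⟩
  rw [BIJ85Eq431DeltaKBridge.inner_deltaOp_torus_eq_dotProduct hk (eta_pow_pos P k P.d) (Lpow_ne_zero P k)]
  rw [← sum_box]
  simp only [dotProduct, Matrix.mulVec]
  refine Finset.sum_congr rfl fun b _ => ?_
  rw [box, Equiv.symm_apply_apply, ← sum_box]
  congr 1
  refine Finset.sum_congr rfl fun b' _ => ?_
  rw [box, Equiv.symm_apply_apply, reDelK_apply (P.L ^ k) (one_le_Lpow P k) (Mk P k) 1 one_pos, idxEquiv_idx, idxEquiv_idx,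
    DeltaK_entry_eq_re_DelK hk 1 one_pos]

/-- the norm in the box variables: `‖B‖² = Σ_p X_p²`. [folklore] -/
private theorem norm_sq_eq_box (B : CoarseSpace P k) : ‖B‖ ^ 2 = ∑ p, box (WithLp.ofLp B) p ^ 2 := by
  rw [EuclideanSpace.real_norm_sq_eq, ← sum_box]
  refine Finset.sum_congr rfl fun b _ => ?_
  rw [box, Equiv.symm_apply_apply]

/-- **(2.153) FOR THE (4.3.1) OPERATOR ON THE CONSTRAINT SUBSPACE `W`, ON THE TORI, NO HYPOTHESIS** — [Balaban1984PropagatorsII] p. 249: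
*"⟨B, Δ_kB⟩ ≥ (γ₀/12d²)L^{−d−1}‖B‖², or Δ_k ≥ (γ₀/12d²)L^{−d−1} (2.153) on the subspace of B satisfying: QB = 0, B(Γ_{y,x}) = 0 for x ∈ B(y)"*,
with the β cell's γ₀ = 1: `(1/12d²)L^{−d−1}‖B‖² ≤ ⟨B, Δ_kB⟩` for `B ∈ W` (pv09's `lowerOnConstrainedT_reDelK_sharp` for the genuine (1.65)
operator through the junction; `d ≥ 2`, `k + 1 ≤ m + K`) — the hypothesis `hcoer` of `BIJ85Ineq434Proof.kernel_decay_unitPropagator`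
DISCHARGED for the torus instance in Bałaban's gauge. [cite: Balaban1984PropagatorsII, (2.153) p.249] -/
theorem coercive_corner (hd : 2 ≤ P.d) (hk : k + 1 ≤ P.m + P.K) (w : Wcorner P k) :
    gamma2153one P.d P.L * ‖(w : CoarseSpace P k)‖ ^ 2 ≤
      ⟪(w : CoarseSpace P k), deltaOp (V411 P k) (curlOp (P := P) (P.eta k ^ P.d) ((P.L : ℝ) ^ k)) (QsE P k)
        (w : CoarseSpace P k)⟫ := by
  have hk' : k ≤ P.m + P.K := by omega
  obtain ⟨hQ, hT⟩ := (mem_Wcorner_iff_box hk (w : CoarseSpace P k)).1 w.2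
  rw [inner_deltaOp_eq_box_form hk', norm_sq_eq_box]
  exact lowerOnConstrainedT_reDelK_sharp hd P.L_pos (P.L ^ k) (one_le_Lpow P k) (L_dvd_Mk hk) _ hQ
    (fun p hp => by rw [box]; exact hT p hp)

/-- the same in the shape `γ‖B‖² ≤ ‖∂H_{k,Ax}B‖²`. [cite: Balaban1984PropagatorsII, (2.153) p.249] -/
theorem coercive_corner' (hd : 2 ≤ P.d) (hk : k + 1 ≤ P.m + P.K) (w : Wcorner P k) :
    gamma2153one P.d P.L * ‖(w : CoarseSpace P k)‖ ^ 2 ≤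
      ‖(curlOp (P := P) (P.eta k ^ P.d) ((P.L : ℝ) ^ k) ∘ₗ
        Hop (V411 P k) (curlOp (P := P) (P.eta k ^ P.d) ((P.L : ℝ) ^ k)) (QsE P k)) (w : CoarseSpace P k)‖ ^ 2 :=
  (BIJ85Ineq434Proof.coercive_iff _ _ _ _ _).1 (coercive_corner hd hk) w

/-- **no zero modes of `∂H_{k,Ax}` on `W`** (so the Gaussian (4.3.3) is non-degenerate), on the tori, no hypothesis.
[cite: BalabanImbrieJaffe1985, (4.3.4) p.311] -/
theorem noZeroModes_corner (hd : 2 ≤ P.d) (hk : k + 1 ≤ P.m + P.K) (w : Wcorner P k)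
    (hw : curlOp (P := P) (P.eta k ^ P.d) ((P.L : ℝ) ^ k)
      (Hop (V411 P k) (curlOp (P := P) (P.eta k ^ P.d) ((P.L : ℝ) ^ k)) (QsE P k) (w : CoarseSpace P k)) = 0) : w = 0 :=
  BIJ85Ineq434Proof.noZeroModes_of_coercive (gamma2153one_pos (by omega) P.L_pos) (coercive_corner' hd hk) w hw

/-- **(4.3.4) ON THE TORI IN BAŁABAN'S GAUGE, NO HYPOTHESIS** — p. 311: *"C^{(k)} is well defined and is bounded in norm ‖C^{(k)}‖ ≤ c (4.3.4)
uniformly in k"*: `‖C^{(k)}J‖ ≤ 12d²L^{d+1}‖J‖` and `0 ≤ ⟨J, C^{(k)}J⟩ ≤ 12d²L^{d+1}‖J‖²` for `C^{(k)} = unitPropagator … Wcorner`, every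
`k + 1 ≤ m + K` (`c = γ⁻¹`, γ = (1/12d²)L^{−d−1} of (2.153)). [cite: BalabanImbrieJaffe1985, (4.3.4) p.311] -/
theorem norm_unitPropagator_corner_le (hd : 2 ≤ P.d) (hk : k + 1 ≤ P.m + P.K) (J : CoarseSpace P k) :
    ‖unitPropagator (V411 P k) (curlOp (P := P) (P.eta k ^ P.d) ((P.L : ℝ) ^ k)) (QsE P k) (Wcorner P k) J‖ ≤
        (gamma2153one P.d P.L)⁻¹ * ‖J‖ ∧
      0 ≤ ⟪J, unitPropagator (V411 P k) (curlOp (P := P) (P.eta k ^ P.d) ((P.L : ℝ) ^ k)) (QsE P k) (Wcorner P k) J⟫ ∧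
      ⟪J, unitPropagator (V411 P k) (curlOp (P := P) (P.eta k ^ P.d) ((P.L : ℝ) ^ k)) (QsE P k) (Wcorner P k) J⟫ ≤
        (gamma2153one P.d P.L)⁻¹ * ‖J‖ ^ 2 :=
  BIJ85Ineq434Proof.norm_unitPropagator_le _ _ _ _ (gamma2153one_pos (by omega) P.L_pos) (coercive_corner hd hk) J

/-- the constant `c = γ⁻¹ = 12d²L^{d+1}` of (4.3.4), unfolded. [cite: BalabanImbrieJaffe1985, (4.3.4) p.311] -/
theorem inv_gamma2153one (d L : ℕ) (hL : 1 ≤ L) : (gamma2153one d L)⁻¹ = 12 * (d : ℝ) ^ 2 * (L : ℝ) ^ ((d : ℝ) + 1) := by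
  have hL' : (0 : ℝ) < L := by exact_mod_cast hL
  rw [gamma2153one, mul_inv, one_div, inv_inv, Real.rpow_neg hL'.le, inv_inv]

/-! ## §4  (2.156) and (7.2.3)/(4.3.5) ON THE TORI IN BAŁABAN'S GAUGE, NO HYPOTHESIS -/

/-- the (4.3.1) matrix in the box variables: `Δ_k = (Re Δ_k).submatrix idx idx`. [cite: BalabanImbrieJaffe1985, (4.3.1) p.311] -/
theorem DeltaK_eq_submatrix (hk : k ≤ P.m + P.K) :
    B5Eq119GaussianV1.DeltaK P k (P.eta k ^ P.d) ((P.L : ℝ) ^ k) =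
      (reDelK (P.L ^ k) (one_le_Lpow P k) (Mk P k)).submatrix (idx P k) (idx P k) := by
  haveI : NeZero (P.L ^ k) := ⟨by have := one_le_Lpow P k; omega⟩
  ext b b'
  rw [Matrix.submatrix_apply, reDelK_apply (P.L ^ k) (one_le_Lpow P k) (Mk P k) 1 one_pos, idxEquiv_idx, idxEquiv_idx,
    DeltaK_entry_eq_re_DelK hk 1 one_pos]

/-- `CᵀΔ_kC` read on the bonds IS pv09's reduced matrix `C*(Re Δ_k)C`. [cite: Balaban1984PropagatorsII, (2.156) p.250] -/
theorem reduced_eq (hk : k ≤ P.m + P.K) :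
    (MC P k)ᵀ * B5Eq119GaussianV1.DeltaK P k (P.eta k ^ P.d) ((P.L : ℝ) ^ k) * MC P k =
      (elimT P.L (Mk P k))ᵀ * reDelK (P.L ^ k) (one_le_Lpow P k) (Mk P k) * elimT P.L (Mk P k) := by
  rw [DeltaK_eq_submatrix hk, MC_eq_submatrix, Matrix.transpose_submatrix, Matrix.submatrix_mul_equiv,
    Matrix.submatrix_mul_equiv, Matrix.submatrix_id_id]

/-- `C X Cᵀ` read on the bonds is the reindexed `C X Cᵀ`. [cite: Balaban1984PropagatorsII, (2.156) p.250] -/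
theorem sandwich_eq (X : Matrix (freeT P.L (Mk P k)) (freeT P.L (Mk P k)) ℝ) :
    MC P k * X * (MC P k)ᵀ = (elimT P.L (Mk P k) * X * (elimT P.L (Mk P k))ᵀ).submatrix (idx P k) (idx P k) := by
  rw [MC_eq_submatrix, Matrix.transpose_submatrix,
    Matrix.submatrix_mul (elimT P.L (Mk P k) * X) (elimT P.L (Mk P k))ᵀ (idx P k) id (idx P k) Function.bijective_id,
    Matrix.submatrix_mul (elimT P.L (Mk P k)) X (idx P k) id id Function.bijective_id, Matrix.submatrix_id_id]

/-- **(2.156) ON THE TORI**: the kernel of the (4.3.3) propagator in Bałaban's gauge IS pv09's covariance `C(C*(Re Δ_k)C)⁻¹C*` of the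
genuine (1.65) operator, reindexed — `C^{(k)}(b, b′) = (B6Cov2156Torus.bondReductionT L M (Re Δ_k)).cov (idx b) (idx b′)`
(`BIJ85Ineq434Proof.kernel_unitPropagator_eq_2156` with every hypothesis a theorem of the tori; `d ≥ 2`, `k + 1 ≤ m + K`).
[cite: Balaban1984PropagatorsII, (2.156) p.250; BalabanImbrieJaffe1985, (4.3.3) p.311] -/
theorem kernel_corner_eq_cov [DecidableEq (PBond P k)] (hd : 2 ≤ P.d) (hk : k + 1 ≤ P.m + P.K) (b b' : PBond P k) :
    unitPropagator (V411 P k) (curlOp (P := P) (P.eta k ^ P.d) ((P.L : ℝ) ^ k)) (QsE P k) (Wcorner P k)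
        (EuclideanSpace.single b' 1) b =
      (bondReductionT P.L (Mk P k) (reDelK (P.L ^ k) (one_le_Lpow P k) (Mk P k))).cov (idx P k b) (idx P k b') := by
  have hk' : k ≤ P.m + P.K := by omega
  have hT := fun w hw => noZeroModes_corner hd hk w hw
  have hA : IsUnit ((MC P k)ᵀ * B5Eq119GaussianV1.DeltaK P k (P.eta k ^ P.d) ((P.L : ℝ) ^ k) * MC P k).det := by
    rw [reduced_eq hk']
    exact ((sandwich_posDef_reDelK hd P.L_pos (L_dvd_Mk hk) (P.L ^ k) (one_le_Lpow P k)).det_pos).ne'.isUnit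
  have hCW : ∀ x, Matrix.toEuclideanLin (MC P k) x ∈ Wcorner P k := fun x => MC_mulVec_mem (WithLp.ofLp x)
  have hWC : ∀ w : Wcorner P k, ∃ x, Matrix.toEuclideanLin (MC P k) x = (w : CoarseSpace P k) := fun w => by
    obtain ⟨x, hx⟩ := (mem_Wcorner_range _).1 w.2
    exact ⟨WithLp.toLp 2 x, hx⟩
  rw [BIJ85Ineq434Proof.kernel_unitPropagator_eq_2156 _ _ _ (Wcorner P k) hT
    (toEuclideanLin_DeltaK_eq_deltaOp hk' (eta_pow_pos P k P.d) (Lpow_ne_zero P k)) (MC P k) hCW hWC hA b b',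
    Matrix.mul_assoc, ← Matrix.mul_assoc, bondReductionT_cov, reduced_eq hk', sandwich_eq, Matrix.submatrix_apply]

/-- **(7.2.3) = (4.3.5) ON THE TORI IN BAŁABAN'S AXIAL GAUGE, WITH NO HYPOTHESIS** — p. 325 [PDF 27]: *"The unit lattice propagator C^{(k)} also
has exponential decay, |C^{(k)}_{μν}(x, y)| ≤ Me^{−δ|x−y|}, (7.2.3) for x, y ∈ T₁^{(k)}. This inequality follows from the bound (2.157) in [6II] and
from the general theorem on unit lattice operators in [7]."* — for the (4.3.3) propagator `C^{(k)} = unitPropagator (V411 P k) (curlOp (η^d) (L^k))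
(QsE P k) Wcorner` of the ACTUAL action Δ_k of (4.3.1) on the tori of the series, the constraint `δ(QB)δ_{Ax}(B)` read with Bałaban's corner-rooted
staircases: there are `M, δ > 0` DEPENDING ON `d` AND `L` ONLY such that `|C^{(k)}_{μν}(x, y)| ≤ Me^{−δ|x−y|}` (`|x − y|` = `supDist`, the torus
distance of `T₁^{(k)}`) for every torus `Setup` with these `d ≥ 2`, `L`, and every scale `k + 1 ≤ m + K` — uniformly in `k` and in the volume.
Every [6II] input is a THEOREM here ((2.153): `coercive_corner`; the decay of Δ_k and (2.156): `BIJ85Eq431DeltaKBridge`, `kernel_corner_eq_cov`;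
Sect. 5 of [7]: inside pv09's `cov2156_torus_DelK`). [cite: BalabanImbrieJaffe1985, (7.2.3) p.325] -/
theorem ineq723_corner (d L : ℕ) (hd : 2 ≤ d) :
    ∃ M δ : ℝ, 0 < M ∧ 0 < δ ∧ ∀ (P : Params), P.d = d → P.L = L → ∀ (k : ℕ) (_ : DecidableEq (PBond P k)),
      k + 1 ≤ P.m + P.K → ∀ b b' : PBond P k,
        |unitPropagator (V411 P k) (curlOp (P := P) (P.eta k ^ P.d) ((P.L : ℝ) ^ k)) (QsE P k) (Wcorner P k)
            (EuclideanSpace.single b' 1) b| ≤ M * Real.exp (-(δ * (supDist b.src b'.src : ℝ))) := by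
  by_cases hL : 1 ≤ L
  · obtain ⟨c, δ, hc, hδ, H⟩ := cov2156_torus_DelK d hd hL
    refine ⟨c, δ, hc, hδ, fun P hP hPL k _ hk b b' => ?_⟩
    subst hP hPL
    rw [kernel_corner_eq_cov hd hk, ← pdist_rep_eq_supDist]
    exact H (Mk P k) (L_dvd_Mk hk) (P.L ^ k) (one_le_Lpow P k) (idx P k b) (idx P k b')
  · refine ⟨1, 1, one_pos, one_pos, fun P _ hPL => ?_⟩
    exact absurd (hPL ▸ P.L_pos) (by omega)

/-- **(7.2.3) IN THE RECORD FORM OF THE SKELETON** (r15's `BIJ85Sect7Statements.KernelData.Ineq723`): for every Sect. 7.2 kernel carrier whose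
`C^{(k)}_{μν}(x, y)` is the kernel of the torus propagator in Bałaban's gauge at the bonds `⟨x, μ⟩`, `⟨y, ν⟩` and whose `|x − y|` is the torus
distance `supDist` of `T₁^{(k)}` (as in `BIJ85Ineq722Torus.torusKernelData`), `Kd.Ineq723 M δ` holds with the `(d, L)`-dependent constants of
`ineq723_corner`, for every scale `k + 1 ≤ m + K`. [cite: BalabanImbrieJaffe1985, (7.2.3) p.325] -/
theorem ineq723_corner_record (d L : ℕ) (hd : 2 ≤ d) :
    ∃ M δ : ℝ, 0 < M ∧ 0 < δ ∧ ∀ (P : Params), P.d = d → P.L = L → ∀ (k : ℕ) (_ : DecidableEq (PBond P k)),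
      k + 1 ≤ P.m + P.K → ∀ (Kd : BIJ85Sect7Statements.KernelData) (site : Kd.SiteU → Balaban1983to89.Site P k)
        (dir : Kd.Dir → Fin P.d),
        (∀ μ ν x y, Kd.C μ ν x y =
          unitPropagator (V411 P k) (curlOp (P := P) (P.eta k ^ P.d) ((P.L : ℝ) ^ k)) (QsE P k) (Wcorner P k)
            (EuclideanSpace.single (⟨site y, dir ν⟩ : PBond P k) 1) ⟨site x, dir μ⟩) →
        (∀ x y, Kd.distU x y = (supDist (site x) (site y) : ℝ)) → Kd.Ineq723 M δ := by
  obtain ⟨M, δ, hM, hδ, H⟩ := ineq723_corner d L hd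
  refine ⟨M, δ, hM, hδ, fun P hP hPL k _ hk Kd site dir hC hdist μ ν x y => ?_⟩
  rw [hC, hdist]
  exact H P hP hPL k _ hk ⟨site x, dir μ⟩ ⟨site y, dir ν⟩

end

end Literature.MathematicalPhysics.QuantumFieldTheory.BalabanImbrieJaffe1984to88.BIJ85Ineq723TorusCornerGauge
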